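import Summits.ABC.ABC.Theorems.Target.Negative.ForcedDivisor
import HarnessLib

/-!
# Crux `Target` (stmt-ABC-2159, route ABC/FeketeScales), line SketchIdeator2 — NEGATIVE LEMMA:
# the ultra-composite-tail stub has the exponent floor `θ ≥ 1/2`

The line's only new stub (`stub_ultraCompositeTail`, "UCT") asserts, for SOME `0 < θ' < θ < 1` and
`A`, that every abc triple with MANY prime factors, `ω(abc) > (log rad(abc))^{θ'}`, has sub-power
excess `c < rad(abc) · exp(A (log rad(abc))^θ)`.  The line card (Lines/SketchIdeator2.md) states without
proof that the restriction to the tail does not lower the exponent window below `1/2`; Bombieri–Gubler's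
Remark 12.4.11 (PDF p. 415: "the number of distinct prime factors of `ac` is `O(y/log y)`") only bounds `ω`
from ABOVE on the Stewart–Tijdeman families [cite: BombieriGubler2006, Rem. 12.4.11].  This file PROVES it:

* `exists_tail_triple` — with `D` = the product of `⌊y^{2τ}⌋ + 2` primes from `(y, 2y]` (prime number
  theorem, tree: `StewartTijdeman.eventually_primeCounting_bounds`) in the sibling
  `ForcedDivisor.exists_triple_cform_forced`: for every `0 ≤ τ < 1/2` and every real `A` an abc triple
  with `ω(abc) > (log rad)^τ`, `log rad ≥ 1` and `c > rad · exp(A (log rad)^τ)`.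
* `not_tail_subpower_of_lt_half` — hence for ALL `θ', θ < 1/2` (any signs, any order) the tail
  statement `∃ A, ∀ abc, (log rad)^{θ'} < ω(abc) → c < rad·exp(A (log rad)^θ)` is FALSE, and
  (`half_le_of_tail_subpower`) every witness `(θ', θ, A)` of the stub with `θ' < θ` has `1/2 ≤ θ`.

So the stub's window is `[1/2, 1)` exactly as for the un-restricted sub-power slack
(`not_subPowerSlack_of_lt_half` in the crux workfile `Cruxes/Target/SketchIdeator2.lean`): demanding
many prime factors buys no exponent.  For `θ ≥ 1/2` a refutation of the stub would refute
`RSTConjectureAUpper` (open), see `Cruxes/Target/Disproof.lean`.  Statements are written with the stub's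
body expanded (no definitions). [cite: BombieriGubler2006, Thm. 12.4.6, 12.4.10]
[cite: StewartTijdeman1986, Theorem 2]
-/

noncomputable section

open Literature.NumberTheory.DiophantineGeometry UniqueFactorizationMonoid Finset
open Filter Asymptotics
open Literature.Barriers.ABC Literature.Barriers.ABC.StewartTijdeman

set_option linter.dupNamespace false

namespace Summit.ABC.ABC.Theorems.Target.Negative

set_option maxHeartbeats 400000 in
/-- **Many prime factors AND large excess.** For `0 ≤ τ < 1/2` and every real `A` there is an abc
triple with `log rad(abc) ≥ 1`, `ω(abc) > (log rad(abc))^τ` and `c > rad(abc) · exp(A (log rad(abc))^τ)`: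
`exists_triple_cform_forced` with `D` the product of `⌊y^{2τ}⌋ + 2` primes from `(y, 2y]` (there are
`≥ y/(2 log y)` of them by the prime number theorem), which costs `log D ≤ (y^{2τ} + 2) log(2y) = o(y/log y)`
of the excess `(3/2) y/log y`, while `(log rad)^τ ≤ (log c)^τ ≤ y^{2τ} = o(y / log y)`.
[cite: BombieriGubler2006, Thm. 12.4.6, 12.4.10] -/
theorem exists_tail_triple {τ : ℝ} (hτ0 : 0 ≤ τ) (hτ : τ < 1 / 2) (A : ℝ) :
    ∃ a b c : ℕ, IsABCTriple a b c ∧ 1 ≤ Real.log ((rad a b c : ℕ) : ℝ) ∧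
      Real.log ((rad a b c : ℕ) : ℝ) ^ τ <
        ((ArithmeticFunction.cardDistinctFactors (a * b * c) : ℕ) : ℝ) ∧
      ((rad a b c : ℕ) : ℝ) * Real.exp (A * Real.log ((rad a b c : ℕ) : ℝ) ^ τ) < c := by
  -- Stewart–Tijdeman with a forced divisor, `η = 1`
  obtain ⟨y₀, hy₀⟩ := exists_triple_cform_forced (η := 1) one_pos le_rfl
  -- the prime number theorem with `ε = 1/10`, and `y ≥ e^6`
  have hev : ∀ᶠ y : ℝ in atTop,
      ((1 - 1 / 10) * (y / Real.log y) ≤ (Nat.primeCounting ⌊y⌋₊ : ℝ) ∧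
        (Nat.primeCounting ⌊y⌋₊ : ℝ) ≤ (1 + 1 / 10) * (y / Real.log y)) ∧ Real.exp 6 ≤ y :=
    (eventually_primeCounting_bounds (by norm_num : (0 : ℝ) < 1 / 10)).and (eventually_ge_atTop _)
  obtain ⟨y₁, hy₁⟩ := Filter.eventually_atTop.mp hev
  -- the size threshold `y₂`
  set s : ℝ := (1 - 2 * τ) / 4 with hs
  have hs0 : 0 < s := by rw [hs]; linarith
  set A' : ℝ := |A| + 1 with hA'
  have hA'1 : 1 ≤ A' := by rw [hA']; linarith [abs_nonneg A]
  have hA'0 : 0 < A' := by linarith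
  set c₀ : ℝ := 27 * A' / (4 * s ^ 2) with hc₀
  have hc₀0 : 0 < c₀ := by positivity
  set y₂ : ℝ := c₀ ^ (1 / (2 * s)) with hy₂
  have hy₂0 : 0 ≤ y₂ := Real.rpow_nonneg hc₀0.le _
  set y : ℕ := max (max y₀ ⌈y₁⌉₊) (max ⌈y₂⌉₊ 3) with hydef
  have hyy₀ : y₀ ≤ y := le_trans (le_max_left _ _) (le_max_left _ _)
  have hy3 : 3 ≤ y := le_trans (le_max_right _ _) (le_max_right _ _)
  have hyceil₁ : ⌈y₁⌉₊ ≤ y := le_trans (le_max_right _ _) (le_max_left _ _)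
  have hyceil₂ : ⌈y₂⌉₊ ≤ y := le_trans (le_max_left _ _) (le_max_right _ _)
  set yr : ℝ := (y : ℝ) with hyr
  have hyr3 : (3 : ℝ) ≤ yr := by rw [hyr]; exact_mod_cast hy3
  have hyr0 : 0 < yr := by linarith
  have hyr1 : 1 ≤ yr := by linarith
  have hyy₁ : y₁ ≤ yr := le_trans (Nat.le_ceil y₁) (by rw [hyr]; exact_mod_cast hyceil₁)
  have hyy₂ : y₂ ≤ yr := le_trans (Nat.le_ceil y₂) (by rw [hyr]; exact_mod_cast hyceil₂)
  -- PNT at `y` and at `2y`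
  obtain ⟨⟨-, hπle⟩, hexp6⟩ := hy₁ yr hyy₁
  have h2yr : y₁ ≤ ((2 * y : ℕ) : ℝ) := by push_cast; rw [← hyr]; linarith
  obtain ⟨⟨hπ2ge, -⟩, -⟩ := hy₁ ((2 * y : ℕ) : ℝ) h2yr
  rw [hyr, Nat.floor_natCast] at hπle
  rw [Nat.floor_natCast] at hπ2ge
  push_cast at hπ2ge
  rw [← hyr] at hπle hπ2ge
  set L : ℝ := Real.log yr with hL
  have hL6 : 6 ≤ L := by
    rw [hL, ← Real.log_exp 6]; exact Real.log_le_log (Real.exp_pos 6) hexp6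
  have hL0 : 0 < L := by linarith
  have hL4 : 4 ≤ L := by linarith
  have hlog2 := Real.log_two_lt_d9
  have hlog2pos : 0 < Real.log 2 := Real.log_pos one_lt_two
  have hlog2yr : Real.log (2 * yr) ≤ 9 / 8 * L := by
    rw [Real.log_mul two_ne_zero hyr0.ne', ← hL]; linarith
  have hlog2yr_pos : 0 < Real.log (2 * yr) := by
    rw [Real.log_mul two_ne_zero hyr0.ne', ← hL]; linarith
  have hπ2 : 8 / 5 * (yr / L) ≤ (Nat.primeCounting (2 * y) : ℝ) := by
    have h1 : 2 * yr / (9 / 8 * L) ≤ 2 * yr / Real.log (2 * yr) :=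
      div_le_div_of_nonneg_left (by positivity) hlog2yr_pos hlog2yr
    have h3 : 8 / 5 * (yr / L) = (1 - 1 / 10) * (2 * yr / (9 / 8 * L)) := by
      field_simp; ring
    rw [h3]
    have h4 := mul_le_mul_of_nonneg_left h1 (by norm_num : (0 : ℝ) ≤ 1 - 1 / 10)
    exact h4.trans hπ2ge
  have hπ1 : (Nat.primeCounting y : ℝ) ≤ 11 / 10 * (yr / L) := by
    have : (1 + 1 / 10 : ℝ) = 11 / 10 := by norm_num
    rw [this] at hπle; exact hπle
  have hdiff : 1 / 2 * (yr / L) ≤ (Nat.primeCounting (2 * y) : ℝ) - Nat.primeCounting y := by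
    linarith
  -- the master size inequality `(y^{2τ} + 2) L² A' ≤ (4/9) y`
  set T : ℝ := yr ^ (2 * τ) + 2 with hT
  have hpow1 : 1 ≤ yr ^ (2 * τ) := Real.one_le_rpow hyr1 (by linarith)
  have hT0 : 0 < T := by rw [hT]; linarith
  have hT3 : T ≤ 3 * yr ^ (2 * τ) := by rw [hT]; linarith
  have hLs : L ≤ yr ^ s / s := Real.log_le_rpow_div hyr0.le hs0
  have hL2 : L ^ 2 ≤ yr ^ (2 * s) / s ^ 2 := by
    have h1 : L ^ 2 ≤ (yr ^ s / s) ^ 2 := pow_le_pow_left₀ hL0.le hLs 2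
    have h2 : (yr ^ s / s) ^ 2 = yr ^ (2 * s) / s ^ 2 := by
      rw [div_pow, ← Real.rpow_two (yr ^ s), ← Real.rpow_mul hyr0.le, mul_comm s 2]
    rwa [h2] at h1
  have h2τ2s : yr ^ (2 * τ) * yr ^ (2 * s) = yr ^ ((1 + 2 * τ) / 2) := by
    rw [← Real.rpow_add hyr0]; congr 1; rw [hs]; ring
  have hsplit : yr ^ ((1 + 2 * τ) / 2) * yr ^ (2 * s) = yr := by
    rw [← Real.rpow_add hyr0]
    have : (1 + 2 * τ) / 2 + 2 * s = 1 := by rw [hs]; ring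
    rw [this, Real.rpow_one]
  have hc₀le : c₀ ≤ yr ^ (2 * s) := by
    have h1 : y₂ ^ (2 * s) ≤ yr ^ (2 * s) := Real.rpow_le_rpow hy₂0 hyy₂ (by linarith)
    have h2 : y₂ ^ (2 * s) = c₀ := by
      rw [hy₂, ← Real.rpow_mul hc₀0.le]
      have : 1 / (2 * s) * (2 * s) = 1 := by field_simp
      rw [this, Real.rpow_one]
    rwa [h2] at h1
  have hM : T * L ^ 2 * A' ≤ 4 / 9 * yr := by
    have h1 : T * L ^ 2 * A' ≤ 3 * yr ^ (2 * τ) * (yr ^ (2 * s) / s ^ 2) * A' :=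
      mul_le_mul (mul_le_mul hT3 hL2 (by positivity) (by positivity)) le_rfl hA'0.le (by positivity)
    have h2 : 3 * yr ^ (2 * τ) * (yr ^ (2 * s) / s ^ 2) * A' =
        3 * A' / s ^ 2 * yr ^ ((1 + 2 * τ) / 2) := by
      rw [← h2τ2s]; field_simp
    have h3 : 3 * A' / s ^ 2 * yr ^ ((1 + 2 * τ) / 2) ≤ 4 / 9 * yr := by
      have hye : 0 ≤ yr ^ ((1 + 2 * τ) / 2) := Real.rpow_nonneg hyr0.le _
      calc 3 * A' / s ^ 2 * yr ^ ((1 + 2 * τ) / 2)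
          = 4 / 9 * (yr ^ ((1 + 2 * τ) / 2) * c₀) := by rw [hc₀]; field_simp; ring
        _ ≤ 4 / 9 * (yr ^ ((1 + 2 * τ) / 2) * yr ^ (2 * s)) := by
            apply mul_le_mul_of_nonneg_left _ (by norm_num)
            exact mul_le_mul_of_nonneg_left hc₀le hye
        _ = 4 / 9 * yr := by rw [hsplit]
    linarith
  -- three consequences
  have hL2A : L ^ 2 ≤ L ^ 2 * A' := le_mul_of_one_le_right (sq_nonneg L) hA'1
  have h4L : 4 * L ≤ L ^ 2 := by nlinarith
  have hTLA : T * (L ^ 2 * A') ≤ 4 / 9 * yr := by rw [← mul_assoc]; exact hM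
  have hC1 : T * (2 * L) ≤ yr := by
    have : T * (2 * L) ≤ T * (L ^ 2 * A') := mul_le_mul_of_nonneg_left (by linarith) hT0.le
    linarith
  have hC2 : T * (9 / 8 * L) ≤ yr / (2 * L) := by
    rw [le_div_iff₀ (by positivity)]
    have : T * (9 / 8 * L) * (2 * L) = 9 / 4 * (T * L ^ 2) := by ring
    rw [this]
    have h1 : T * L ^ 2 ≤ T * (L ^ 2 * A') := mul_le_mul_of_nonneg_left hL2A hT0.le
    linarith
  have hC3 : |A| * yr ^ (2 * τ) ≤ yr / L := by
    rw [le_div_iff₀ hL0]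
    have h1 : |A| * yr ^ (2 * τ) ≤ A' * T := by
      have : yr ^ (2 * τ) ≤ T := by rw [hT]; linarith
      exact mul_le_mul (by rw [hA']; linarith) this (by linarith) hA'0.le
    have h2 : A' * T * L * 4 ≤ T * (L ^ 2 * A') := by
      have : A' * T * L * 4 = T * A' * (4 * L) := by ring
      rw [this, show T * (L ^ 2 * A') = T * A' * L ^ 2 by ring]
      exact mul_le_mul_of_nonneg_left h4L (by positivity)
    nlinarith [h1, h2, hTLA, hL0, hyr0]
  -- `w = ⌊y^{2τ}⌋ + 2` primes from `(y, 2y]`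
  set w : ℕ := ⌊yr ^ (2 * τ)⌋₊ + 2 with hw
  have hwT : (w : ℝ) ≤ T := by
    rw [hw, hT]; push_cast
    linarith [Nat.floor_le (Real.rpow_nonneg hyr0.le (2 * τ))]
  have hw_gt : yr ^ (2 * τ) + 1 < (w : ℝ) := by
    rw [hw]; push_cast
    linarith [Nat.lt_floor_add_one (yr ^ (2 * τ))]
  have hw2 : 2 ≤ w := by rw [hw]; omega
  have hwcard : (w : ℝ) ≤ 1 / 2 * (yr / L) := by
    have h1 : (w : ℝ) * (2 * L) ≤ yr := le_trans (mul_le_mul_of_nonneg_right hwT (by positivity)) hC1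
    rw [show 1 / 2 * (yr / L) = yr / (2 * L) by field_simp, le_div_iff₀ (by positivity)]
    exact h1
  have hlogD_le : (w : ℝ) * Real.log (2 * yr) ≤ yr / (2 * L) := by
    calc (w : ℝ) * Real.log (2 * yr) ≤ T * (9 / 8 * L) :=
          mul_le_mul hwT hlog2yr hlog2yr_pos.le hT0.le
      _ ≤ yr / (2 * L) := hC2
  set S₂ : Finset ℕ := Nat.primesLE (2 * y) \ Nat.primesLE y with hS₂
  have hsub : Nat.primesLE y ⊆ Nat.primesLE (2 * y) := fun p hp => by
    rw [Nat.mem_primesLE] at hp ⊢; exact ⟨by omega, hp.2⟩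
  have hcardS₂ : S₂.card = Nat.primeCounting (2 * y) - Nat.primeCounting y := by
    rw [hS₂, card_sdiff_of_subset hsub, Nat.primesLE_card_eq_primeCounting,
      Nat.primesLE_card_eq_primeCounting]
  have hmono : Nat.primeCounting y ≤ Nat.primeCounting (2 * y) := Nat.monotone_primeCounting (by omega)
  have hwS₂ : w ≤ S₂.card := by
    have h : (w : ℝ) ≤ (Nat.primeCounting (2 * y) : ℝ) - Nat.primeCounting y := by linarith
    rw [hcardS₂]
    have : (w : ℝ) ≤ ((Nat.primeCounting (2 * y) - Nat.primeCounting y : ℕ) : ℝ) := by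
      rw [Nat.cast_sub hmono]; exact h
    exact_mod_cast this
  obtain ⟨t, htS₂, htcard⟩ := Finset.exists_subset_card_eq hwS₂
  have htprime : ∀ p ∈ t, p.Prime := fun p hp => Nat.prime_of_mem_primesLE (mem_sdiff.mp (htS₂ hp)).1
  have htgt : ∀ p ∈ t, y < p := by
    intro p hp
    obtain ⟨h1, h2⟩ := mem_sdiff.mp (htS₂ hp)
    by_contra hle
    exact h2 (Nat.mem_primesLE.mpr ⟨not_lt.mp hle, Nat.prime_of_mem_primesLE h1⟩)
  have htle : ∀ p ∈ t, p ≤ 2 * y := fun p hp => Nat.le_of_mem_primesLE (mem_sdiff.mp (htS₂ hp)).1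
  set D : ℕ := ∏ p ∈ t, p with hD
  have hD0 : 0 < D := prod_pos fun p hp => (htprime p hp).pos
  have hDpf : D.primeFactors = t := Nat.primeFactors_prod htprime
  have hDprime : ∀ p ∈ D.primeFactors, y < p := fun p hp => htgt p (hDpf ▸ hp)
  have hlogD : Real.log (D : ℝ) ≤ yr / (2 * L) := by
    have h1 : Real.log (D : ℝ) = ∑ p ∈ t, Real.log (p : ℝ) := by
      rw [hD, Nat.cast_prod, Real.log_prod]
      intro p hp; exact_mod_cast (htprime p hp).ne_zero
    have h2 : ∑ p ∈ t, Real.log (p : ℝ) ≤ ∑ p ∈ t, Real.log (2 * yr) := by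
      refine sum_le_sum fun p hp => Real.log_le_log (by exact_mod_cast (htprime p hp).pos) ?_
      have : ((p : ℕ) : ℝ) ≤ ((2 * y : ℕ) : ℝ) := by exact_mod_cast htle p hp
      push_cast at this; rwa [← hyr] at this
    rw [h1]
    calc ∑ p ∈ t, Real.log (p : ℝ) ≤ ∑ p ∈ t, Real.log (2 * yr) := h2
      _ = w * Real.log (2 * yr) := by rw [sum_const, nsmul_eq_mul, htcard]
      _ ≤ yr / (2 * L) := hlogD_le
  -- the triple
  have hlogD' : Real.log (D : ℝ) ≤ (y : ℝ) / (2 * Real.log y) := by rw [← hyr]; exact hlogD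
  obtain ⟨a, b, c, habc, hcX, hyc, hDb, hexc⟩ := hy₀ y hyy₀ D hD0 hDprime hlogD'
  rw [← hyr] at hcX hexc
  obtain ⟨ha0, hb0, hsum, hcop⟩ := habc
  have hc0 : 0 < c := by omega
  have hc0R : (0 : ℝ) < c := by exact_mod_cast hc0
  have hc1R : (1 : ℝ) ≤ c := by exact_mod_cast hc0
  have hD0R : (0 : ℝ) < D := by exact_mod_cast hD0
  have hrad1 : 1 ≤ rad a b c := by rw [rad_def]; exact Nat.radical_pos _
  have hrad0 : (0 : ℝ) < rad a b c := by exact_mod_cast hrad1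
  have habc0 : a * b * c ≠ 0 := by positivity
  -- `t ⊆ primeFactors(abc)`, so `ω(abc) ≥ w` and `rad ≥ y + 1`
  have htsub : t ⊆ (a * b * c).primeFactors := by
    intro p hp
    have hpD : p ∣ D := by rw [hD]; exact dvd_prod_of_mem _ hp
    have hpb : p ∣ a * b * c := (hpD.trans hDb).trans (dvd_mul_of_dvd_left (dvd_mul_left b a) c)
    exact Nat.mem_primeFactors.mpr ⟨htprime p hp, hpb, habc0⟩
  have hω : w ≤ ArithmeticFunction.cardDistinctFactors (a * b * c) := by
    have hωcard : ArithmeticFunction.cardDistinctFactors (a * b * c) = (a * b * c).primeFactors.card := by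
      rw [ArithmeticFunction.cardDistinctFactors_apply, ← List.card_toFinset]; rfl
    rw [hωcard, ← htcard]; exact card_le_card htsub
  have hrad4 : (y : ℝ) + 1 ≤ rad a b c := by
    obtain ⟨p, hp⟩ := Finset.card_pos.mp (by rw [htcard]; omega : 0 < t.card)
    have hpdvd : p ∣ radical (a * b * c) := by
      rw [Nat.radical_eq_prod_primeFactors]; exact dvd_prod_of_mem _ (htsub hp)
    have hple : p ≤ rad a b c := by rw [rad_def]; exact Nat.le_of_dvd (Nat.radical_pos _) hpdvd
    have := htgt p hp
    exact_mod_cast (show y + 1 ≤ rad a b c by omega)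
  have hlogr1 : 1 ≤ Real.log (rad a b c : ℝ) := by
    rw [Real.le_log_iff_exp_le hrad0]
    have := Real.exp_one_lt_d9
    rw [← hyr] at hrad4
    linarith
  have hlogr0 : 0 ≤ Real.log (rad a b c : ℝ) := by linarith
  -- the excess in logarithms: `log rad + Y < log c`
  have hexcess : Real.log (rad a b c : ℝ) + yr / L < Real.log c := by
    have h1 := Real.log_lt_log (by positivity) hexc
    rw [Real.log_mul hrad0.ne' (Real.exp_pos _).ne', Real.log_exp,
      Real.log_mul hc0R.ne' hD0R.ne'] at h1
    have h2 : (2 - 1 / 2) * yr / Real.log yr = 3 / 2 * (yr / L) := by rw [hL]; ring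
    rw [h2] at h1
    have h3 : yr / (2 * L) = 1 / 2 * (yr / L) := by field_simp
    rw [h3] at hlogD
    linarith
  have hY0 : 0 < yr / L := div_pos hyr0 hL0
  have hradc : Real.log (rad a b c : ℝ) ≤ Real.log c := by linarith
  have hlogc : Real.log (c : ℝ) ≤ yr ^ 2 := by
    have := Real.log_le_log hc0R hcX
    rwa [Real.log_exp] at this
  -- `(log rad)^τ ≤ y^{2τ}`
  have hLτ : Real.log (rad a b c : ℝ) ^ τ ≤ yr ^ (2 * τ) := by
    calc Real.log (rad a b c : ℝ) ^ τ ≤ Real.log (c : ℝ) ^ τ := Real.rpow_le_rpow hlogr0 hradc hτ0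
      _ ≤ (yr ^ 2) ^ τ := Real.rpow_le_rpow (Real.log_nonneg hc1R) hlogc hτ0
      _ = yr ^ (2 * τ) := by rw [← Real.rpow_two, ← Real.rpow_mul hyr0.le]
  refine ⟨a, b, c, ⟨ha0, hb0, hsum, hcop⟩, hlogr1, ?_, ?_⟩
  · -- many prime factors
    have hωR : (w : ℝ) ≤ ((ArithmeticFunction.cardDistinctFactors (a * b * c) : ℕ) : ℝ) := by
      exact_mod_cast hω
    linarith
  · -- large excess
    have hA1 : A * Real.log (rad a b c : ℝ) ^ τ ≤ yr / L := by
      calc A * Real.log (rad a b c : ℝ) ^ τ ≤ |A| * Real.log (rad a b c : ℝ) ^ τ :=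
            mul_le_mul_of_nonneg_right (le_abs_self A) (Real.rpow_nonneg hlogr0 _)
        _ ≤ |A| * yr ^ (2 * τ) := mul_le_mul_of_nonneg_left hLτ (abs_nonneg A)
        _ ≤ yr / L := hC3
    calc (rad a b c : ℝ) * Real.exp (A * Real.log (rad a b c : ℝ) ^ τ)
        = Real.exp (Real.log (rad a b c : ℝ) + A * Real.log (rad a b c : ℝ) ^ τ) := by
          rw [Real.exp_add, Real.exp_log hrad0]
      _ < Real.exp (Real.log c) := Real.exp_lt_exp.mpr (by linarith)
      _ = c := Real.exp_log hc0R

/-- **The tail stub is false below one half.** For all real `θ', θ < 1/2` there is NO `A` with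
`c < rad(abc) · exp(A (log rad(abc))^θ)` for every abc triple with `ω(abc) > (log rad(abc))^{θ'}`
(the body of `stub_ultraCompositeTail` / `LargeOmegaSubPower θ' θ` of line SketchIdeator2 at fixed
exponents).  From `exists_tail_triple` at `τ = max(θ', θ, 0)`. -/
theorem not_tail_subpower_of_lt_half {θ' θ : ℝ} (hθ' : θ' < 1 / 2) (hθ : θ < 1 / 2) :
    ¬ ∃ A : ℝ, ∀ a b c : ℕ, IsABCTriple a b c →
      Real.log ((rad a b c : ℕ) : ℝ) ^ θ' <
        ((ArithmeticFunction.cardDistinctFactors (a * b * c) : ℕ) : ℝ) →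
      (c : ℝ) < ((rad a b c : ℕ) : ℝ) * Real.exp (A * Real.log ((rad a b c : ℕ) : ℝ) ^ θ) := by
  rintro ⟨A, hA⟩
  set τ : ℝ := max (max θ' θ) 0 with hτdef
  have hτ0 : 0 ≤ τ := le_max_right _ _
  have hτ : τ < 1 / 2 := max_lt (max_lt hθ' hθ) (by norm_num)
  have hθ'τ : θ' ≤ τ := le_trans (le_max_left _ _) (le_max_left _ _)
  have hθτ : θ ≤ τ := le_trans (le_max_right _ _) (le_max_left _ _)
  obtain ⟨a, b, c, habc, hL1, hω, hexc⟩ := exists_tail_triple hτ0 hτ (|A|)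
  set Lr : ℝ := Real.log ((rad a b c : ℕ) : ℝ) with hLr
  have h1 : Lr ^ θ' ≤ Lr ^ τ := Real.rpow_le_rpow_of_exponent_le hL1 hθ'τ
  have h2 : Lr ^ θ ≤ Lr ^ τ := Real.rpow_le_rpow_of_exponent_le hL1 hθτ
  have hlt := hA a b c habc (lt_of_le_of_lt h1 hω)
  have hrad0 : (0 : ℝ) ≤ ((rad a b c : ℕ) : ℝ) := Nat.cast_nonneg _
  have h3 : ((rad a b c : ℕ) : ℝ) * Real.exp (A * Lr ^ θ) ≤
      ((rad a b c : ℕ) : ℝ) * Real.exp (|A| * Lr ^ τ) := by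
    apply mul_le_mul_of_nonneg_left _ hrad0
    apply Real.exp_le_exp.mpr
    have hLθ : 0 ≤ Lr ^ θ := Real.rpow_nonneg (by linarith) _
    calc A * Lr ^ θ ≤ |A| * Lr ^ θ := mul_le_mul_of_nonneg_right (le_abs_self A) hLθ
      _ ≤ |A| * Lr ^ τ := mul_le_mul_of_nonneg_left h2 (abs_nonneg A)
  linarith

/-- **Exponent floor of the stub.** Every witness `(θ', θ, A)` of line SketchIdeator2's
`stub_ultraCompositeTail` (equivalently of `LargeOmegaSubPower θ' θ` with `θ' < θ`) has `θ ≥ 1/2`: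
restricting to the ultra-composite tail `ω(abc) > (log rad)^{θ'}` does not lower the exponent window
`[1/2, 1)` of the sub-power slack. -/
theorem half_le_of_tail_subpower {θ' θ A : ℝ} (hθ'θ : θ' < θ)
    (h : ∀ a b c : ℕ, IsABCTriple a b c →
      Real.log ((rad a b c : ℕ) : ℝ) ^ θ' <
        ((ArithmeticFunction.cardDistinctFactors (a * b * c) : ℕ) : ℝ) →
      (c : ℝ) < ((rad a b c : ℕ) : ℝ) * Real.exp (A * Real.log ((rad a b c : ℕ) : ℝ) ^ θ)) :
    1 / 2 ≤ θ := by
  by_contra hlt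
  have hθ : θ < 1 / 2 := not_le.mp hlt
  exact not_tail_subpower_of_lt_half (hθ'θ.trans hθ) hθ ⟨A, h⟩

end Summit.ABC.ABC.Theorems.Target.Negative
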